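import Summits.BirchSwinnertonDyer.BirchSwinnertonDyer.Theorems.ClassRecordThreeCornerAtThreeBranches
import Summits.BirchSwinnertonDyer.BirchSwinnertonDyer.Theorems.ClassRecordThreeCornerAtThreeUpperHybridPos
import Summits.BirchSwinnertonDyer.BirchSwinnertonDyer.Theorems.ClassRecordThreeCornerAtThreeUpperConverse
import Summits.BirchSwinnertonDyer.BirchSwinnertonDyer.Theorems.ClassRecordThreeCornerAtThreeUpperShimuraDefs
import Summits.BirchSwinnertonDyer.BirchSwinnertonDyer.Theses.KolyvaginRoadThree

/-!
# BC3 skeleton (LINE, pre-registration form) — crux 7 `CornerAtThree` (item stmt-BirchSwinnertonDyer-19111; K2@3 `ClassRecordThree`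
# rank 7, shared BY STATEMENT with `KolyvaginRoadThree`) — line `Lines/inert.lean` (width-lever second lane `bsd-stepL-corner3-p2` g4;
# planner g36 RULING 31 (C))

= the REGISTERED skeleton of record `Lines/hybrid.lean` (fdd33f489294074e; lane B g2 ∕ planner g35 RULING 26 (a)) VERBATIM except:
* the IMC-grade stub `stub_upper3_coStepLMulti` (lane B's `Three.CornerCoStepLAt` on the 70 MULTI-carrier corner pairs) is REPLACED by
  - `stub_upper3_inertDisplay` — the CARRIER-INERT Shimura road's inputs: the inert order-bound display at `3` on the corner
    (`Theorems.CornerAtThreeShimuraInertDisplay`, the ONE new typed object, classical-Kolyvagin-grade, reading (R1) at inert `3`; Defs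
    file `ClassRecordThreeCornerAtThreeUpperShimuraDefs.lean`) ∧ the two SHARED registered objects the road reads VERBATIM — crux 19616's
    registered stub (7) `stub_orderBound_irredNonSurjAtThree` (split road) and crux 19109's registered `stub_x11aLowerHalfAtThree` (= item
    19064 at `3`; both roads) — bundled in ONE stub under the cap (each conjunct is, by statement, the registered object of its own crux;
    the planner may unbundle if a slot frees);
  - `stub_upper3_residualMulti` — `Three.CornerCoStepLAt W` restricted to MULTI-carrier corner curves that are NOT inert-admissible
    (`¬ Three.CornerInertAdmissible W`; census N < 5·10⁵: 8 of the 70 multi pairs — EVIDENCE, T7), the IMC-grade residue of record;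
* the two by-name fact bundles `stub_upper3_hybridFacts` and `stub_cornerFacts3` are MERGED into ONE `stub_cornerFacts3` (the 13 Kato-twin facts
  of birth ∧ lane A's four ∧ lane B's four ∧ the inert road's print: Gross–Zagier, Hoffstein–Luo, Mazur's Manin constant, Friedberg–Hoffstein
  inert, Barrios et al., Jacquet–Langlands supply, Pasten component orders, Cai–Shu–Tian companion) — CITABLE, never «proved» here;
* `cornerUpper3_of_inertStubs` DERIVES birth's `stub_cornerUpper3 : Theorems.CornerAtThreeUpper` = (A) ∘ (G) ∘ {lane A's
  `stub_upper3_jetchevMaxMono`, `stub_upper3_residualMulti`}: conjunct 2 class-wide from the twist stubs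
  (`X11b.cornerTwistAt_of_lowerTwists_of_katoFacts_of_muAn`); the residual binder of the glue (G)
  `cornerAtThreeUpperConsumed_of_display_of_residual` (p554046) from J₃-MAX on mono-carrier curves (`Koly.cornerUpperAt_of_jetchevMaxAt_of_monoCarrier`)
  and `Three.CornerCoStepLAt` on the non-admissible multi-carrier ones (g0's `cornerUpperAt_of_cornerCoStepLAt_of_facts`) through x11b3-p8's
  forward bridge; then the CONVERSE bridge (A) `cornerAtThreeUpper_of_consumed_of_twist` (p553450).
Stubs 7 = stubs_max: `stub_cornerStepL3`, `stub_upper3_jetchevMaxMono`, `stub_upper3_inertDisplay`, `stub_upper3_residualMulti`,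
`stub_cornerTwistLower3`, `stub_cornerTwistMuAn3`, `stub_cornerFacts3`. Sorries only in `stub_*`. Both compositions (`CornerAtThree_of` ⊢ the
K2@3 decl, `CornerAtThreeKoly_of` ⊢ the KOLY decl, via `Theorems.cornerAtThree_of_branchesAn` p489722) conclude the crux BY NAME. Nothing is
asserted about any curve (T7). Published as a LINE (evidence); registering it (`skeleton check`) is the planner's call (RULING 31 (C): «inert
supersedes hybrid» iff the IMC-grade population drops 70 → 8 and every other open stub is classical-grade).
-/

set_option linter.dupNamespace false
set_option autoImplicit false

namespace Summit.BirchSwinnertonDyer.BirchSwinnertonDyer.Cruxes.CornerAtThree.Inert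

open scoped Classical NumberField
open CongruenceSubgroup WeierstrassCurve NumberField IsDedekindDomain Literature.NumberTheory.EllipticCurves
  Literature.NumberTheory.EllipticCurves.ModularForms Literature.NumberTheory.GaloisCohomology
  Literature.NumberTheory.EllipticCurves.Rank1Residual Literature.NumberTheory.EllipticCurves.Rank1Residual.Typed
  Literature.NumberTheory.EllipticCurves.BarriosEtAl2025 Literature.NumberTheory.Automorphic
  Summit.BirchSwinnertonDyer.Rank1Residual
  Summit.BirchSwinnertonDyer.Rank1Residual.X11b Summit.BirchSwinnertonDyer.Rank1Residual.X11b.Three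
  Summit.BirchSwinnertonDyer.BirchSwinnertonDyer.Theorems

/-- **stub StepL** — conjunct 1 on the corner: `∀ W, Three.CornerStepLAt W` (S0-currency STEP L at 3; kit: oriented halves). Hybrid verbatim. -/
theorem stub_cornerStepL3 : Summit.BirchSwinnertonDyer.BirchSwinnertonDyer.Theorems.CornerAtThreeStepL := by
  sorry

/-- **stub (Jetchev MAX form at 3 on MONO-carrier corner curves with `3 ∣ ∏c`)** — lane A's `stub_upper3_jetchevMax`
restricted to `3 ∣ ∏c ∧ ∃ v, ord₃ ∏c ≤ ord₃ c_v`: `P_n ∈ 3^s E(K[n])` for all `s ≤ ord₃ c_v(E/ℚ)` at Kolyvagin levels of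
index `≥ s`. [shape: Jetchev2008 Thm. 1.4, printed for p ∤ N, ρ̄ onto] OPEN (classical; kernel road = lane A's swap + walk). Hybrid verbatim. -/
theorem stub_upper3_jetchevMaxMono :
    ∀ (W : WeierstrassCurve ℚ) [W.IsElliptic] [W.IsGloballyMinimal] [NeZero (W.conductorNorm ℤ)]
      (K : Type) [Field K] [NumberField K]
      (Dt : ModularParametrizationData W (W.conductorNorm ℤ)) (β : ℤ) (ι : K →+* ℂ),
      3 ∣ W.tamagawaProduct →
      (∃ v : HeightOneSpectrum (𝓞 ℚ),
        padicValNat 3 W.tamagawaProduct ≤ padicValNat 3 (W.tamagawaNumberAt v)) →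
      ClassX11b W 3 → ¬ Surj W 3 →
      IsImaginaryQuadratic K → SatisfiesHeegnerHypothesis (W.conductorNorm ℤ) K →
      Odd (NumberField.discr K) →
      (4 * (W.conductorNorm ℤ : ℤ)) ∣ β ^ 2 - NumberField.discr K → ¬ (3 : ℤ) ∣ Dt.c →
      ∀ (v : HeightOneSpectrum (𝓞 ℚ)) (s : ℕ), s ≤ padicValNat 3 (W.tamagawaNumberAt v) →
        ∀ (n : ℕ) (d : KolyvaginHeegnerData Dt β ι n), Squarefree n →
          (∀ ℓ ∈ n.primeFactors, Zhang2014.IsKolyvaginPrime (W.conductorNorm ℤ) W K 3 ℓ ∧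
            s ≤ Zhang2014.kolyvaginIndex W 3 ℓ) → Koly.PDiv d 3 s := by
  sorry

/-- **stub (the carrier-INERT Shimura road's inputs, bundled under the stub cap)** — conjunct 1: the inert order-bound display at `3`
on the (T4″)₃ corner, `Theorems.CornerAtThreeShimuraInertDisplay` (the ONE new typed object of lane B g3's road: Cai–Shu–Tian Gross–Zagier
display on `X_{N⁺,N⁻}` with `3 ∣ N⁻`, the degree link at `3`, Kolyvagin's UNSHARP bound; classical-Kolyvagin-grade, reading (R1) at the inert
place; printed twin p ≥ 5, ρ̄ onto = Kim 2024 Thm. 4.3); conjunct 2: crux 19616's REGISTERED stub (7) `stub_orderBound_irredNonSurjAtThree`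
VERBATIM (the ¬Surj slice of the Shimura order bound at `3`, split road; shared BY STATEMENT); conjunct 3: crux 19109's REGISTERED
`stub_x11aLowerHalfAtThree` VERBATIM (= item 19064 read at `3`: the X11a lower half; shared BY STATEMENT). OPEN (classical-grade ×3; none IMC-grade). -/
theorem stub_upper3_inertDisplay :
    Summit.BirchSwinnertonDyer.BirchSwinnertonDyer.Theorems.CornerAtThreeShimuraInertDisplay ∧
    (∀ (W : WeierstrassCurve ℚ) [W.IsElliptic] [W.IsGloballyMinimal] (p : ℕ) [Fact p.Prime]
      (N : ℕ) [NeZero N] (K : Type) [Field K] [NumberField K] (S : Finset ℕ)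
      (Dt : ModularParametrizationData W N)
      (X : ShimuraCurveData (∏ q ∈ S, q) (N / ∏ q ∈ S, q))
      (W' : WeierstrassCurve ℚ) [W'.IsElliptic] (P₀ : ShimuraParametrizationData X W'),
      W.conductorNorm ℤ = N → ¬ Surj W 3 → p ≠ 2 → W.HasIrreducibleModPGaloisRep p →
      IsImaginaryQuadratic K → Even S.card →
      (∀ ℓ ∈ S, ℓ.Prime ∧ ℓ ∣ N ∧ ¬ ℓ ^ 2 ∣ N ∧
        ((Ideal.span {(ℓ : ℤ)}).primesOver (𝓞 K)).ncard = 1 ∧ ¬ (ℓ : ℤ) ∣ NumberField.discr K) →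
      (∀ ℓ : ℕ, ℓ.Prime → ℓ ∣ N → ℓ ∉ S → ((Ideal.span {(ℓ : ℤ)}).primesOver (𝓞 K)).ncard = 2) →
      ((Ideal.span {(p : ℤ)}).primesOver (𝓞 K)).ncard = 2 →
      P₀.IsMinimalFor W →
      p ∣ N → p = 3 →
      ∀ (P : (W.baseChange K).toAffine.Point) (degS : ℕ), 0 < degS →
        padicValNat p degS = padicValNat p P₀.deg →
        LDerivEK W K =
          8 * (Real.pi : ℂ) ^ 2 * peterssonProduct (Gamma0 N) 2 Dt.f Dt.f /
              ((((Units.torsionOrder K : ℝ) / 2) ^ 2 * √|(NumberField.discr K : ℝ)| : ℝ) : ℂ) *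
            ((P.canonicalHeight : ℂ) / (degS : ℂ)) →
        ¬ IsOfFinAddOrder P →
          Nat.card (AddCommGroup.primaryComponent (W.baseChange K).sha p) ≤
            p ^ (2 * padicValNat p (AddSubgroup.zmultiples P).index)) ∧
    (∀ (V : WeierstrassCurve ℚ) [V.IsElliptic] [V.IsGloballyMinimal],
      ClassX11a V 3 → Typed.MissingLowerBoundAt V 3) := by
  sorry

/-- **stub (the «⊇» half at 𝟙 on the NON-ADMISSIBLE MULTI-carrier corner curves)** — lane B's `Three.CornerCoStepLAt W` restricted to
`∀ v, ord₃ c_v < ord₃ ∏c` (multi-carrier) ∧ `¬ Three.CornerInertAdmissible W` (no admissible carrier-inert Shimura frame: census 8 of the 70 multi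
pairs N < 5·10⁵ — 74778v1 168222b1 240306t1 278850il1 289338bd1 364485k1 493680gx1 493680hj1 — EVIDENCE, T7). OPEN (IMC-grade; Howard 2004 Thm. B ∕
BCK21 ∕ BCS24 need (sur) or exclude dihedral primes and `p = 3`; TIGHT: ⟺ `Three.CornerUpperAt W` modulo cited facts). The residue of record. -/
theorem stub_upper3_residualMulti :
    ∀ (W : WeierstrassCurve ℚ) [W.IsElliptic] [W.IsGloballyMinimal],
      (∀ v : HeightOneSpectrum (𝓞 ℚ),
        padicValNat 3 (W.tamagawaNumberAt v) < padicValNat 3 W.tamagawaProduct) →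
      ¬ Three.CornerInertAdmissible W → CornerCoStepLAt W := by
  sorry

/-- **stub TwistLower** — the 3-part lower bound at every odd Heegner twin (kit: by sign; Skinner 2016 void — no (ram)). Hybrid verbatim. -/
theorem stub_cornerTwistLower3 : Summit.BirchSwinnertonDyer.BirchSwinnertonDyer.Theorems.CornerAtThreeTwistLower := by
  sorry

/-- **stub TwistMuAn** — analytic μ = 0 at 3 at every odd Heegner twin (kit v2: non-split unit-value CLOSED p499490, non-unit, split). Hybrid verbatim. -/
theorem stub_cornerTwistMuAn3 : Summit.BirchSwinnertonDyer.BirchSwinnertonDyer.Theorems.CornerAtThreeTwistMuAn := by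
  sorry

/-- **stub Facts (MERGED, by name; CITABLE, never «proved» here)** — conjunct 1: birth's bundle `KatoTwinFactsThreeAn` (13 NAMED print facts:
Stein–Wuthrich Thm 6.1 ×2, GZK, entire L, parametrisation supply, Greenberg–Stevens, Kato nonempty_iwasawaH1Data ∕ Thm 12.4 ∕ §17.13 inputs
non-split ∕ split, Greenberg 1999 Thm 1.5, Wuthrich 2014 Cor 18, Kato §17.13 fine) VERBATIM (so `CornerAtThree_of` feeds it to the glue unchanged);
then lane A's four (Kolyvagin; Shimura reciprocity at conductor 1; Darmon 2004 Thm. 3.6; Cha 2005 Rmk. 25), lane B's three more (newforms;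
Poitou–Tate ×2), and the inert road's print (Gross–Zagier; Hoffstein–Luo; Mazur's Manin constant at odd p; Friedberg–Hoffstein inert twist;
Barrios et al. c₂ of twists; Jacquet–Langlands ∕ Shimura parametrisation supply; Pasten 2024 component orders; Cai–Shu–Tian Gross–Zagier on
`X_{N⁺,N⁻}`). All are `def … : Prop` facts of Literature taken BY NAME. -/
theorem stub_cornerFacts3 :
    (Literature.NumberTheory.EllipticCurves.SteinWuthrich2013.thm61_splitMultiplicative ∧
      Literature.NumberTheory.EllipticCurves.SteinWuthrich2013.thm61_nonsplitMultiplicative ∧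
      Literature.NumberTheory.EllipticCurves.rank_eq_analyticRank_of_analyticRank_le_one ∧
      WeierstrassCurve.hasEntireLFunction_rat ∧
      Literature.NumberTheory.EllipticCurves.ModularForms.nonempty_modularParametrizationData ∧
      (∀ (W : WeierstrassCurve ℚ) [W.IsElliptic] [W.IsGloballyMinimal] (p : ℕ) [Fact p.Prime],
        Literature.NumberTheory.EllipticCurves.greenberg_stevens W p) ∧
      Literature.NumberTheory.EllipticCurves.Kato2004.nonempty_iwasawaH1Data ∧
      Literature.NumberTheory.EllipticCurves.Kato2004.thm12_4 ∧
      Literature.NumberTheory.EllipticCurves.Kato2004.exists_multDivisibilityInputs_nonsplit ∧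
      Literature.NumberTheory.EllipticCurves.Kato2004.exists_multDivisibilityInputs_split ∧
      Literature.NumberTheory.EllipticCurves.Greenberg1999.thm15_isTorsion_multiplicative_rat ∧
      Literature.NumberTheory.EllipticCurves.Wuthrich2014.corollary18_padicLFunction_mem_iwasawaAlgebra_multiplicative ∧
      Literature.NumberTheory.EllipticCurves.Kato2004.exists_multDivisibilityInputs_fine) ∧
    (∀ (N : ℕ) [NeZero N] (W : WeierstrassCurve ℚ) (K : Type) [Field K] [NumberField K], kolyvagin N W K) ∧
    (∀ (N : ℕ) [NeZero N] (W : WeierstrassCurve ℚ) (K : Type) [Field K] [NumberField K],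
      heegnerPointOfConductor_one_galoisConj N W K) ∧
    (∀ (N : ℕ) [NeZero N] (W : WeierstrassCurve ℚ) (K : Type) [Field K] [NumberField K],
      phi_heegnerTau_mem_singularModuliField N W K) ∧
    Cha2005.rmk25_padicValNat_card_sha_primary_add_le_of_globalDivisibility ∧
    exists_isNewformOf ∧
    (∀ (K : Type) [Field K] [NumberField K], poitouTate_selmerStructure_duality K) ∧
    (∀ (K : Type) [Field K] [NumberField K], poitouTate_sha_tateDual K) ∧
    (∀ (N : ℕ) [NeZero N] (W : WeierstrassCurve ℚ) (K : Type) [Field K] [NumberField K], gross_zagier N W K) ∧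
    HoffsteinLuo1997_exists_twist_L_one_ne_zero ∧
    mazur_not_dvd_maninConstant_of_odd ∧
    friedbergHoffstein_exists_twist_ne_zero_inertAt ∧
    localTamagawaNumber_quadraticTwist_two_mem_of_goodReduction ∧
    nonempty_shimuraParametrizationData ∧
    PastenShimura2024_componentOrders ∧
    shimuraCurve_heegnerPoint_grossZagier := by
  sorry

/-- **Conjunct 2 class-wide from the twist stubs** (`X11b.cornerTwistAt_of_lowerTwists_of_katoFacts_of_muAn`, corner-p1 g6; exactly what the
glue `cornerAtThree_of_branchesAn` does inside). No `sorry` of its own. -/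
theorem cornerTwist3_of_twistStubs :
    ∀ (W : WeierstrassCurve ℚ) [W.IsElliptic] [W.IsGloballyMinimal], CornerTwistAt W := by
  obtain ⟨⟨hJs, hJn, hGZK, hmod, hpar, hGS, hne, h12, hns, hsp, h15, h18, hfine⟩, -⟩ := stub_cornerFacts3
  intro W _ _
  exact cornerTwistAt_of_lowerTwists_of_katoFacts_of_muAn hJs hJn hGZK hmod hpar hGS hne h12 hns hsp h15 h18 hfine W
    (fun K _ _ Wd _ _ Cd ↦ stub_cornerTwistLower3 W K Wd Cd) (fun K _ _ Wd _ _ Cd ↦ stub_cornerTwistMuAn3 W K Wd Cd)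

/-- **The RESIDUAL binder of the glue (G)**: on a corner curve with `3 ∣ ∏c` and NO admissible carrier-inert frame, the ℚ-level Euler-system
half from lane A's J₃-MAX (mono-carrier: `Koly.cornerUpperAt_of_jetchevMaxAt_of_monoCarrier`, p538853) or from `stub_upper3_residualMulti`
(multi-carrier: g0's `cornerUpperAt_of_cornerCoStepLAt_of_facts`, p532389), through x11b3-p8's forward bridge
`Three.missingUpperBoundAt_of_cornerUpperAt` with conjunct 2. No `sorry` of its own. -/
theorem residual3_of_stubs [Fact (Nat.Prime 3)] :
    ∀ (W : WeierstrassCurve ℚ) [W.IsElliptic] [W.IsGloballyMinimal],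
      ClassX11b W 3 → ¬ Surj W 3 → 3 ∣ W.tamagawaProduct → ¬ Three.CornerInertAdmissible W →
      Typed.MissingUpperBoundAt W 3 := by
  obtain ⟨⟨-, -, hGZK, hmod, -⟩, hKo, hrec, hD36, hChaU, hnf, hPT, hPT2, hGZ, hHL, hMaz, -⟩ := stub_cornerFacts3
  intro W _ _ hX hns ht hnadm
  have hU : CornerUpperAt W := by
    by_cases hmono : ∃ v : HeightOneSpectrum (𝓞 ℚ),
        padicValNat 3 W.tamagawaProduct ≤ padicValNat 3 (W.tamagawaNumberAt v)
    · exact Koly.cornerUpperAt_of_jetchevMaxAt_of_monoCarrier hKo hrec hD36 hChaU W hmono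
        (fun K _ _ Dt β ι hX hns hK hHN hodd hβ hc v s hs n d hn hℓ ↦
          stub_upper3_jetchevMaxMono W K Dt β ι ht hmono hX hns hK hHN hodd hβ hc v s hs n d hn hℓ)
    · push Not at hmono
      exact cornerUpperAt_of_cornerCoStepLAt_of_facts W hGZK hnf hPT hPT2 (stub_upper3_residualMulti W hmono hnadm)
  exact Three.missingUpperBoundAt_of_cornerUpperAt hGZ hKo hGZK hmod hnf hHL hMaz W hX hns ht hU (cornerTwist3_of_twistStubs W)

/-- **Conjunct 3 in its CONSUMER shape, class-wide** — the glue (G) `cornerAtThreeUpperConsumed_of_display_of_residual` (p554046) on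
{display bundle, residual binder, print}. No `sorry` of its own. -/
theorem cornerUpperConsumed3_of_inertStubs : Summit.BirchSwinnertonDyer.BirchSwinnertonDyer.Theorems.CornerAtThreeUpperConsumed := by
  haveI : Fact (Nat.Prime 3) := ⟨Nat.prime_three⟩
  obtain ⟨⟨-, -, hGZK, hmod, -⟩, -, -, -, -, hnf, -, -, -, -, hMaz, hFH, hBR, hJL, hCO, hGZc⟩ := stub_cornerFacts3
  obtain ⟨hI, h7, hX11a⟩ := stub_upper3_inertDisplay
  exact cornerAtThreeUpperConsumed_of_display_of_residual hGZK hmod hnf hFH hMaz hBR hJL hCO hGZc h7 hI hX11a residual3_of_stubs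

/-- **Conjunct 3 (birth's `stub_cornerUpper3`) — DERIVED, not a stub of this line**: the CONVERSE bridge (A)
`cornerAtThreeUpper_of_consumed_of_twist` (p553450) on the consumer shape (G) and conjunct 2. No `sorry` of its own. -/
theorem cornerUpper3_of_inertStubs : Summit.BirchSwinnertonDyer.BirchSwinnertonDyer.Theorems.CornerAtThreeUpper := by
  haveI : Fact (Nat.Prime 3) := ⟨Nat.prime_three⟩
  obtain ⟨⟨-, -, hGZK, hmod, -⟩, hKo, -, -, -, -, -, -, hGZ, -⟩ := stub_cornerFacts3
  exact cornerAtThreeUpper_of_consumed_of_twist hGZ hKo hGZK hmod cornerTwist3_of_twistStubs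
    (fun W _ _ hX hns ht ↦ cornerUpperConsumed3_of_inertStubs W hX hns ht)

/-! ## (planner reshape r1, plan g37 — registration hygiene) The `Statement` abbrev namespace of the g4 draft is removed: the
composition binders below are typed by the registered obligations `Theorems.CornerAtThreeStepL ∕ …Upper ∕ …TwistLower ∕ …TwistMuAn`
BY NAME (syntactically the stub types), and the CITABLE facts bundle `stub_cornerFacts3` is consumed inside the composition, so that
(i) `#h21_check_skeleton` finds every hypothesis admissible whichever crux-concluding theorem it inspects first and (ii) every
`stub_*` short name resolves to exactly ONE local declaration (the sorried theorem), giving the registry the true signatures.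
Stubs, statements and proofs are VERBATIM corner3-p2 g4 (sha16 3ca0b2059f86a6e5). -/

/-! ## The composition (sorry-free): the stub STATEMENTS imply the crux, BY NAME, on BOTH routes -/

/-- **`CornerAtThree_of`** — corner-p1 g6's glue `Theorems.cornerAtThree_of_branchesAn` (p489722) ⊢ the K2@3 ROUTE decl (facts = conjunct 1 of
the merged bundle, consumed inside). -/
theorem CornerAtThree_of (hS : Summit.BirchSwinnertonDyer.BirchSwinnertonDyer.Theorems.CornerAtThreeStepL)
    (hU : Summit.BirchSwinnertonDyer.BirchSwinnertonDyer.Theorems.CornerAtThreeUpper)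
    (hL : Summit.BirchSwinnertonDyer.BirchSwinnertonDyer.Theorems.CornerAtThreeTwistLower)
    (hμ : Summit.BirchSwinnertonDyer.BirchSwinnertonDyer.Theorems.CornerAtThreeTwistMuAn) :
    Summit.BirchSwinnertonDyer.BirchSwinnertonDyer.Theses.ClassRecordThree.CornerAtThree :=
  Summit.BirchSwinnertonDyer.BirchSwinnertonDyer.Theorems.cornerAtThree_of_branchesAn hS hU hL hμ stub_cornerFacts3.1

/-- **`CornerAtThreeKoly_of`** — the same term ⊢ the KOLY route's by-statement copy of the crux. -/
theorem CornerAtThreeKoly_of (hS : Summit.BirchSwinnertonDyer.BirchSwinnertonDyer.Theorems.CornerAtThreeStepL)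
    (hU : Summit.BirchSwinnertonDyer.BirchSwinnertonDyer.Theorems.CornerAtThreeUpper)
    (hL : Summit.BirchSwinnertonDyer.BirchSwinnertonDyer.Theorems.CornerAtThreeTwistLower)
    (hμ : Summit.BirchSwinnertonDyer.BirchSwinnertonDyer.Theorems.CornerAtThreeTwistMuAn) :
    Summit.BirchSwinnertonDyer.BirchSwinnertonDyer.Theses.KolyvaginRoadThree.CornerAtThree :=
  Summit.BirchSwinnertonDyer.BirchSwinnertonDyer.Theorems.cornerAtThree_of_branchesAn hS hU hL hμ stub_cornerFacts3.1

/-- The crux along this line (K2@3), MODULO exactly the stubs (sorries only in `stub_*`). -/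
theorem CornerAtThree_proof : Summit.BirchSwinnertonDyer.BirchSwinnertonDyer.Theses.ClassRecordThree.CornerAtThree :=
  CornerAtThree_of stub_cornerStepL3 cornerUpper3_of_inertStubs stub_cornerTwistLower3 stub_cornerTwistMuAn3

/-- The crux along this line (KOLY), MODULO exactly the stubs. -/
theorem CornerAtThreeKoly_proof : Summit.BirchSwinnertonDyer.BirchSwinnertonDyer.Theses.KolyvaginRoadThree.CornerAtThree :=
  CornerAtThreeKoly_of stub_cornerStepL3 cornerUpper3_of_inertStubs stub_cornerTwistLower3 stub_cornerTwistMuAn3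

end Summit.BirchSwinnertonDyer.BirchSwinnertonDyer.Cruxes.CornerAtThree.Inert
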